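import Summits.BirchSwinnertonDyer.BirchSwinnertonDyer.Theorems.MordellShaFreeCutThreeAdicLinksCorank
import Summits.BirchSwinnertonDyer.Rank1Residual.X11b.BDPRouteLocalIndexTransport
import Literature.NumberTheory.EllipticCurves.StrictSelmerRankOne
import Literature.NumberTheory.EllipticCurves.BSDSelmerParityDokchitserBaseChangeProofs
import Literature.NumberTheory.EllipticCurves.LeadingTermProofs
import Literature.NumberTheory.EllipticCurves.IwasawaLeadingTermProofs
import Literature.NumberTheory.EllipticCurves.SelmerCorankHolds
import Literature.NumberTheory.EllipticCurves.QuadraticTwistSelmerPInfty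

set_option autoImplicit false

/-! # Route `MordellShaFreeCut` (rung S2b) — crux `RankPosOfThreeSelmerCorankOne`
(stmt-BirchSwinnertonDyer-19159), line `heegner-field-links` v5: the (res) stub
`stub_threeLocNonDegeneracy` HOLDS at rank-one data and is IMPLIED by crux A; binder-carrying forms of
`stub_descentField` and `stub_heegnerPointSupply`

Cell `bsd-cn100`, prover seat `bsd-cn100-s2b-c3` g3. Supports, does not close,
stmt-BirchSwinnertonDyer-19159 (`--supports … --as helper`). HONEST FRAMING: nothing here proves crux A
`RankPosOfThreeSelmerCorankOne`, crux B, the leaf `rankOne_threeConverse_mordellCurve`, Sylvester's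
conjecture or any case of BSD. The v5 skeleton (plan g11, sha16 78cca4aa) cuts the Ш-freeness half of
the rank-one `3`-converse for the `j = 0` curves into: (res) in SELMER currency at the primes above `3`
(`stub_threeLocNonDegeneracy`, XL OPEN), one W,p-general algebra statement modulo Poitou–Tate
(`stub_selmerAcBaseFinite_of_resCorankOne`), the textbook fact, Link B, and two citation-borne stubs.
This file records, in the kernel, the two HONESTY claims of that cut which its docstring states in prose:

* **(res) is a theorem at rank-one data** — `locNonDegeneracy_of_rankOne` (GENERIC: any elliptic
  `W/ℚ`, any prime `p`, any imaginary quadratic `K` with `p` split, any `w ∣ p`): `rank W(K) = 1 ∧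
  #Ш(W/K)[p^∞] < ∞ ⟹ Sel_{p^∞}(W/K) ∩ ker (H¹(K, W[p^∞]) → H¹(K_w, W(K̄_w)[p^∞]))` is finite. This is
  the tree theorem `finite_strictSelmer_of_mordellWeilRank_eq_one_of_hom` (Skinner 2020 §2.2 Lemma
  `rank1lemma` / Kim 2022 (res)), so far instantiated only at `ℚ_[p]` over `ℚ`
  (`finite_strictSelmer_of_mordellWeilRank_eq_one`), fed here at the COMPLETION `K_w` of a degree-one
  prime with `λ = λ_{ℚ_p} ∘ (E(K_w) ≃ E(ℚ_p))` (Silverman AEC VII.6.3 +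
  `X11b.LocalIndexTransport.pointTransportPadic`); `threeLocNonDegeneracy_of_rankOne` is the `p = 3`,
  `j = 0` form in the binder order of the registered stub.
* **crux A ⟹ (res)** — `threeLocNonDegeneracy_of_cruxA`: `RankPosOfThreeSelmerCorankOne` implies the
  registered `stub_threeLocNonDegeneracy` statement VERBATIM, through the TREE THEOREMS
  `selmerCorank_baseChange_quadratic_holds` (Dokchitser–Dokchitser 2010 Lemma 4.14:
  `corank(W/K) = corank(W/ℚ) + corank(W^{d_K}/ℚ)`), `mordellWeilRank_baseChange_quadratic_holds`,
  `selmerCorank_eq_mordellWeilRank_add_holds` (`corank = rank + corank Ш`) and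
  `finite_primaryComponent_sha_iff_shaCorank_eq_zero`: one of `W`, `W^{d_K}` has `3^∞`-Selmer
  corank one, both have `j = 0`, so crux A (transported to every elliptic `j = 0` model by
  `exists_variableChange_eq_mordellCurve_of_j_eq_zero` + the variable-change invariances) gives
  `rank W(K) ≥ 1 = corank`, whence `rank W(K) = 1`, `#Ш(W/K)[3^∞] < ∞`, and the first bullet applies.
  So the (res) research kernel of v5 is NECESSARY: the cut loses nothing (no named fact used).
* `descentField_of_facts`, `heegnerPointSupply_of_gross` — the registered `stub_descentField`
  (`p = 3`, `W`-general) and `stub_heegnerPointSupply` statements token for token after the binders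
  `3`-parity / modularity / Hoffstein–Luo / Kato, resp. Gross 1984 `exists_isHeegnerPoint`
  (the day-1 currency for citation-borne stubs, read2-sk-3).

[cite: Skinner2020, §2.2 (Lemma rank1lemma and the preceding paragraph) and §3]
[cite: Kim2022, §1 (sentence preceding Cor. 1.4) with Prop. 2.10]
[cite: DokchitserDokchitserAnnals2010, Lemma 4.14] [cite: SilvermanAEC2009, Prop. VII.6.3 and Exercise 10.16]
[cite: Greenberg1999LNM, §1 pp. 54–57] [cite: Gross1984, §§3–4] -/

noncomputable section

open scoped Classical

namespace Summit.BirchSwinnertonDyer.BirchSwinnertonDyer.Theorems.MordellShaFreeCutLocNonDegeneracy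

open WeierstrassCurve NumberField IsDedekindDomain Field
open Literature.NumberTheory.EllipticCurves
open Summit.BirchSwinnertonDyer.Rank1Residual.X11b
open Summit.BirchSwinnertonDyer.BirchSwinnertonDyer.Theses.MordellShaFreeCut
open Summit.BirchSwinnertonDyer.BirchSwinnertonDyer.Theorems.MordellShaFreeCutOfHeegnerNonTorsion
  (exists_variableChange_eq_mordellCurve_of_j_eq_zero)

/-! ## 1. (res) at a degree-one prime from rank one and finite `Ш[p^∞]` — generic -/

/-- **(res) at a degree-one prime `w ∣ p` from `rank W(K) = 1 ∧ #Ш(W/K)[p^∞] < ∞`** (any elliptic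
`W/ℚ`, any number field `K`, any prime `p`, any `w ∣ p` with `e(w|p) = f(w|p) = 1`): the `w`-strict
Selmer group `Sel_{p^∞}(W/K) ∩ ker (H¹(K, W[p^∞]) → H¹(K_w, W(K̄_w)[p^∞]))` is finite. Proof:
`finite_strictSelmer_of_mordellWeilRank_eq_one_of_hom` with `λ : W(K_w) → ℤ_p` vanishing exactly on
the torsion, obtained from Silverman VII.6.3 over `ℚ_p` (`exists_addMonoidHom_padicInt_apply_eq_zero_iff`)
along the transport `W(K_w) ≃+ W(ℚ_p)` (`LocalIndexTransport.pointTransportPadic`).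
[cite: Skinner2020, §2.2 (Lemma rank1lemma) and §3] [cite: SilvermanAEC2009, Prop. VII.6.3] -/
theorem locNonDegeneracy_of_rankOne_of_degreeOne (W : WeierstrassCurve ℚ) [W.IsElliptic] (p : ℕ)
    [Fact p.Prime] (K : Type) [Field K] [NumberField K]
    (hrank : (W.baseChange K).mordellWeilRank = 1)
    (hsha : Finite (AddCommGroup.primaryComponent (W.baseChange K).sha p))
    (w : HeightOneSpectrum (𝓞 K)) (hw : ((p : ℕ) : 𝓞 K) ∈ w.asIdeal)
    (he : w.asIdeal.ramificationIdx (𝓞 ℚ) = 1) (hf : w.asIdeal.inertiaDeg (𝓞 ℚ) = 1) :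
    Finite ↥((W.baseChange K).selmerGroupPInfty p ⊓
      selmerLocalKerPrimaryTorsion (W.baseChange K) (w.adicCompletion K) p) := by
  haveI hEK : (W.baseChange K).IsElliptic := by rw [baseChange]; infer_instance
  haveI hEp : (W.baseChange ℚ_[p]).IsElliptic := by rw [baseChange]; infer_instance
  haveI : CharZero (w.adicCompletion K) :=
    charZero_of_injective_algebraMap (algebraMap K (w.adicCompletion K)).injective
  haveI := hsha
  obtain ⟨lam, hlam⟩ := exists_addMonoidHom_padicInt_apply_eq_zero_iff p (W.baseChange ℚ_[p])
  -- the transport `W(K_w) ≃+ W(ℚ_p)` (kept opaque: only additivity and injectivity are used)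
  have e : ((W.baseChange K).baseChange (w.adicCompletion K)).toAffine.Point ≃+
      (W.baseChange ℚ_[p]).toAffine.Point :=
    LocalIndexTransport.pointTransportPadic K p w hw he hf W
  have hinj : Function.Injective e.toAddMonoidHom := e.injective
  have hlam' : ∀ X, (lam.comp e.toAddMonoidHom) X = 0 ↔ IsOfFinAddOrder X := fun X ↦ by
    rw [AddMonoidHom.comp_apply, hlam (e.toAddMonoidHom X)]
    exact hinj.isOfFinAddOrder_iff
  exact finite_strictSelmer_of_mordellWeilRank_eq_one_of_hom (W.baseChange K) p
    (w.adicCompletion K) (lam.comp e.toAddMonoidHom) hlam' hrank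

/-- **(res) at every `w ∣ p` for `p` split in an imaginary quadratic field, from
`rank W(K) = 1 ∧ #Ш(W/K)[p^∞] < ∞`** — the conclusion shape of the v5 stubs
`stub_twoLocNonDegeneracy` / `stub_threeLocNonDegeneracy` and the (res) hypothesis of
`stub_selmerAcBaseFinite_of_resCorankOne`, at rank-one data (`degreeOne_of_splitsIn`).
[cite: Skinner2020, §2.2 (Lemma rank1lemma) and §3] [cite: Kim2022, §1 with Prop. 2.10] -/
theorem locNonDegeneracy_of_rankOne (W : WeierstrassCurve ℚ) [W.IsElliptic] (p : ℕ) [Fact p.Prime]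
    (K : Type) [Field K] [NumberField K] (hK : IsImaginaryQuadratic K) (hsplit : SplitsIn K p)
    (hrank : (W.baseChange K).mordellWeilRank = 1)
    (hsha : Finite (AddCommGroup.primaryComponent (W.baseChange K).sha p))
    (w : HeightOneSpectrum (𝓞 K)) (hw : ((p : ℕ) : 𝓞 K) ∈ w.asIdeal) :
    Finite ↥((W.baseChange K).selmerGroupPInfty p ⊓
      selmerLocalKerPrimaryTorsion (W.baseChange K) (w.adicCompletion K) p) := by
  obtain ⟨he, hf⟩ := degreeOne_of_splitsIn hK.1 hsplit hw
  exact locNonDegeneracy_of_rankOne_of_degreeOne W p K hrank hsha w hw he hf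

/-- **`stub_threeLocNonDegeneracy` at rank-one data** (the binders of the registered stub, with
`corank_{ℤ₃} Sel_{3^∞}(W/K) = 1` replaced by `rank W(K) = 1 ∧ #Ш(W/K)[3^∞] < ∞`; the hypothesis
`j = 0` is not used): a THEOREM — Skinner's (res) at the primes above `3`.
[cite: Skinner2020, §2.2 (Lemma rank1lemma) and §3] -/
theorem threeLocNonDegeneracy_of_rankOne :
    ∀ (W : WeierstrassCurve ℚ) [W.IsElliptic] [W.IsGloballyMinimal], W.j = 0 →
      ∀ (K : Type) [Field K] [NumberField K],
      IsImaginaryQuadratic K → SatisfiesHeegnerHypothesis 3 K →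
        (W.baseChange K).mordellWeilRank = 1 →
        Finite (AddCommGroup.primaryComponent (W.baseChange K).sha 3) →
      ∀ (w : HeightOneSpectrum (𝓞 K)), ((3 : ℕ) : 𝓞 K) ∈ w.asIdeal →
        Finite ↥((W.baseChange K).selmerGroupPInfty 3 ⊓
          selmerLocalKerPrimaryTorsion (W.baseChange K) (w.adicCompletion K) 3) := by
  intro W _ _ _hj K _ _ hK hH3 hrank hsha w hw
  haveI : Fact (Nat.Prime 3) := ⟨Nat.prime_three⟩
  exact locNonDegeneracy_of_rankOne W 3 K hK (hH3 3 Nat.prime_three (dvd_refl 3)) hrank hsha w hw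

/-! ## 2. Crux A implies the (res) stub -/

/-- **Crux A transported to every elliptic `V/ℚ` with `j = 0`**: `V` is `ℚ`-isomorphic to a Mordell
curve `E_D` (`exists_variableChange_eq_mordellCurve_of_j_eq_zero`), `D ≠ 0` by ellipticity, and the
`3^∞`-Selmer corank and the Mordell–Weil rank are invariant under the change of variables
(`selmerCorank_eq_of_variableChange`, `mordellWeilRank_variableChange_holds`).
[cite: SilvermanAEC2009, III.§1 (short Weierstrass form) and III.3.1(b)] -/
theorem one_le_mordellWeilRank_of_jZero_of_cruxA (hA : RankPosOfThreeSelmerCorankOne)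
    (V : WeierstrassCurve ℚ) [V.IsElliptic] (hj : V.j = 0) (hc : V.selmerCorank 3 = 1) :
    1 ≤ V.mordellWeilRank := by
  obtain ⟨C, D, hCD⟩ := exists_variableChange_eq_mordellCurve_of_j_eq_zero V hj
  haveI hE : (mordellCurve D).IsElliptic := hCD ▸ inferInstance
  have hD : D ≠ 0 := by
    have hΔ := (WeierstrassCurve.isElliptic_iff _).mp hE
    rw [mordellCurve_Δ, isUnit_iff_ne_zero] at hΔ
    rintro rfl
    exact hΔ (by norm_num)
  have hc' : (mordellCurve D).selmerCorank 3 = 1 := by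
    rw [← selmerCorank_eq_of_variableChange 3 hCD]; exact hc
  have h1 : 1 ≤ (mordellCurve D).mordellWeilRank := hA hD hc'
  have hrk : (C • V).mordellWeilRank = V.mordellWeilRank := mordellWeilRank_variableChange_holds V C
  rw [← hrk, hCD]
  exact h1

/-- **Crux A `RankPosOfThreeSelmerCorankOne` implies the registered (res) stub
`stub_threeLocNonDegeneracy` (statement VERBATIM)** — the v5 docstring's «conversely crux A ⇒ this
cheaply» in the kernel, from TREE THEOREMS only: `corank(W/K) = corank(W/ℚ) + corank(W^{d_K}/ℚ)`
(`selmerCorank_baseChange_quadratic_holds`, Dokchitser–Dokchitser 2010 Lemma 4.14),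
`rank W(K) = rank W(ℚ) + rank W^{d_K}(ℚ)` (`mordellWeilRank_baseChange_quadratic_holds`),
`corank = rank + corank Ш` (`selmerCorank_eq_mordellWeilRank_add_holds`) and
`finite_primaryComponent_sha_iff_shaCorank_eq_zero`: corank one over `K` puts corank one on exactly one
of `W`, `W^{d_K}` (both `j = 0`), crux A gives that curve a rational point of infinite order, so
`1 ≤ rank W(K) ≤ corank = 1`, `Ш(W/K)[3^∞]` is finite, and `locNonDegeneracy_of_rankOne` concludes.
Hence (res) at `3` is a CONSEQUENCE of crux A used toward crux A; nothing is asserted about either.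
[cite: DokchitserDokchitserAnnals2010, Lemma 4.14] [cite: Skinner2020, §2.2 (Lemma rank1lemma) and §3]
[cite: Greenberg1999LNM, §1 pp. 54–57] -/
theorem threeLocNonDegeneracy_of_cruxA (hA : RankPosOfThreeSelmerCorankOne) :
    ∀ (W : WeierstrassCurve ℚ) [W.IsElliptic] [W.IsGloballyMinimal], W.j = 0 →
      ∀ (K : Type) [Field K] [NumberField K],
      IsImaginaryQuadratic K → SatisfiesHeegnerHypothesis 3 K →
        (W.baseChange K).selmerCorank 3 = 1 →
      ∀ (w : HeightOneSpectrum (𝓞 K)), ((3 : ℕ) : 𝓞 K) ∈ w.asIdeal →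
        Finite ↥((W.baseChange K).selmerGroupPInfty 3 ⊓
          selmerLocalKerPrimaryTorsion (W.baseChange K) (w.adicCompletion K) 3) := by
  intro W _ _ hj K _ _ hK hH3 hcK w hw
  haveI : Fact (Nat.Prime 3) := ⟨Nat.prime_three⟩
  haveI hEK : (W.baseChange K).IsElliptic := by rw [baseChange]; infer_instance
  have hd : (NumberField.discr K : ℚ) ≠ 0 := by exact_mod_cast NumberField.discr_ne_zero K
  haveI hEd : (W.quadraticTwist (NumberField.discr K : ℚ)).IsElliptic := W.isElliptic_quadraticTwist hd
  -- the two decompositions over the quadratic field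
  have hdec : (W.baseChange K).selmerCorank 3 =
      W.selmerCorank 3 + (W.quadraticTwist (NumberField.discr K : ℚ)).selmerCorank 3 :=
    selmerCorank_baseChange_quadratic_holds W K hK.1 3
  have hrkdec : (W.baseChange K).mordellWeilRank =
      W.mordellWeilRank + (W.quadraticTwist (NumberField.discr K : ℚ)).mordellWeilRank :=
    mordellWeilRank_baseChange_quadratic_holds W K hK.1
  rw [hcK] at hdec
  -- a point of infinite order over `K`, from crux A on `W` or on `W^{d_K}`
  have hrk1 : 1 ≤ (W.baseChange K).mordellWeilRank := by
    rcases Nat.eq_zero_or_pos (W.selmerCorank 3) with h0 | hpos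
    · have hct : (W.quadraticTwist (NumberField.discr K : ℚ)).selmerCorank 3 = 1 := by omega
      have hjt : (W.quadraticTwist (NumberField.discr K : ℚ)).j = 0 := by
        rw [W.j_quadraticTwist hd]; exact hj
      have h1 := one_le_mordellWeilRank_of_jZero_of_cruxA hA _ hjt hct
      rw [hrkdec]; omega
    · have hcW : W.selmerCorank 3 = 1 := by omega
      have h1 := one_le_mordellWeilRank_of_jZero_of_cruxA hA W hj hcW
      rw [hrkdec]; omega
  -- `rank ≤ corank = 1`: rank one and `Ш[3^∞]` of corank zero, i.e. finite
  have hid : (W.baseChange K).selmerCorank 3 =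
      (W.baseChange K).mordellWeilRank + (W.baseChange K).shaCorank 3 :=
    (W.baseChange K).selmerCorank_eq_mordellWeilRank_add_holds 3
  rw [hcK] at hid
  have hrank : (W.baseChange K).mordellWeilRank = 1 := by omega
  have hsha0 : (W.baseChange K).shaCorank 3 = 0 := by omega
  have hsha : Finite (AddCommGroup.primaryComponent (W.baseChange K).sha 3) :=
    (finite_primaryComponent_sha_iff_shaCorank_eq_zero (W.baseChange K) 3).2 hsha0
  exact locNonDegeneracy_of_rankOne W 3 K hK (hH3 3 Nat.prime_three (dvd_refl 3)) hrank hsha w hw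

/-! ## 3. The two citation-borne stubs after their binders -/

/-- **`stub_descentField` of line `heegner-field-links` v5 from refereed facts** (statement after the
binders = the registered stub, token for token; `p = 3`, `W`-general): granted `3`-parity (`hpar`),
modularity (`hmod`), Hoffstein–Luo (`hHL`) and Kato (`hKato`), an elliptic `W/ℚ` with
`corank_{ℤ₃} Sel_{3^∞}(W/ℚ) = 1` has an imaginary quadratic `K` with the Heegner hypothesis for `N(W)`
and for `3`, `corank_{ℤ₃} Sel_{3^∞}(W/K) = 1` and `rank W(K) = rank W(ℚ)` — the generic landed
`exists_heegnerField_descent_of_selmerCorank_eq_one` at `p = 3` with conjuncts dropped (cf.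
`MordellShaFreeCutDescentField.descentField_of_parity_of_hoffsteinLuo_of_kato`, p412978, for the
`mordellCurve D` spelling). [cite: DokchitserDokchitserAnnals2010, Thm. 1.4] [cite: Kato2004, Cor. 14.3]
[cite: HoffsteinLuo1997, Theorem (§1)] -/
theorem descentField_of_facts
    (hpar : ∀ (W : WeierstrassCurve ℚ) [W.IsElliptic] (p : ℕ) [Fact p.Prime], p_parity W p)
    (hmod : ModularForms.exists_isNewformOf) (hHL : HoffsteinLuo1997_exists_twist_L_one_ne_zero)
    (hKato : ∀ (W : WeierstrassCurve ℚ) [W.IsElliptic] (p : ℕ) [Fact p.Prime],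
      kato_finite_of_L_one_ne_zero W p) :
    ∀ (W : WeierstrassCurve ℚ) [W.IsElliptic], W.selmerCorank 3 = 1 →
      ∃ (K : Type) (_ : Field K) (_ : NumberField K),
        IsImaginaryQuadratic K ∧
          SatisfiesHeegnerHypothesis (W.conductorNorm ℤ) K ∧
            SatisfiesHeegnerHypothesis 3 K ∧
              (W.baseChange K).selmerCorank 3 = 1 ∧
                (W.baseChange K).mordellWeilRank = W.mordellWeilRank := by
  intro W _ hc
  haveI : Fact (Nat.Prime 3) := ⟨Nat.prime_three⟩
  obtain ⟨K, _, _, hK, -, hHN, hH3, -, -, hcK, hrk, -⟩ :=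
    exists_heegnerField_descent_of_selmerCorank_eq_one hpar hmod hHL hKato W 3 hc 0
  exact ⟨K, inferInstance, inferInstance, hK, hHN, hH3, hcK, hrk⟩

/-- **`stub_heegnerPointSupply` of line `heegner-field-links` v5 from Gross 1984** (statement after
the binder = the registered stub, token for token): granted `exists_isHeegnerPoint` (`hHP`), a
globally minimal elliptic `W/ℚ` has a Heegner point of level `N = N(W)` over every imaginary quadratic
`K` with the Heegner hypothesis for `N`. [cite: Gross1984, §§3–4] [cite: GrossZagier1986, I.§4] -/
theorem heegnerPointSupply_of_gross
    (hHP : ∀ (W : WeierstrassCurve ℚ) (K : Type) [Field K] [NumberField K],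
      exists_isHeegnerPoint W K) :
    ∀ (W : WeierstrassCurve ℚ) [W.IsElliptic] [W.IsGloballyMinimal]
      (K : Type) [Field K] [NumberField K] (N : ℕ) [NeZero N],
      W.conductorNorm ℤ = N → IsImaginaryQuadratic K → SatisfiesHeegnerHypothesis N K →
        ∃ P : (W.baseChange K).toAffine.Point, IsHeegnerPoint N W K P := by
  intro W _ _ K _ _ N _ hN hK hH
  subst hN
  exact hHP W K hK hH

end Summit.BirchSwinnertonDyer.BirchSwinnertonDyer.Theorems.MordellShaFreeCutLocNonDegeneracy

end
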